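import Summits.BirchSwinnertonDyer.BirchSwinnertonDyer.Theorems.SchneiderFreeAdditiveX3KYReadLogDescent
import Summits.BirchSwinnertonDyer.Rank1Residual.Additive.RamifiedTwistMinimality
import Summits.BirchSwinnertonDyer.Rank1Residual.Additive.GordTwistMinimalModel
import Literature.NumberTheory.EllipticCurves.QuadraticTwistJInvariantProofs
import HarnessLib
import HarnessLib.Audit.Tags

/-!
# Route `SchneiderFreeAdditiveX3` (K1 door), crux `PotMultBranchIMC` (stmt-BirchSwinnertonDyer-19176):
# the TWIST DESCENT OF THE LOGARITHM on the (M) cell — door-c3 gen 10's descent theorem WITHOUT `p ∤ Δ_{W'}`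

Cell `bsd-schneider-ideate` (HOME `run/shared/lean/pub/bsd-schneider-ideate/`), seat `door-c2` gen 11.
PARTITION: board row B6 ∩ X3 ∩ sst-twist, `r = 1`, (M) half (X3 ∧ (M), 4 541 of 7 101 pairs) of
`Rank1Residual.partition`; types-the-object-of the one arithmetic step between a PRINT-SHAPED conductor-`p`
value formula for the multiplicative partner and the value clause of crux r2's research stub
`PotMultRead.KYCHMOrientedX3`; closes nothing (BSD is not advanced; the crux stays OPEN).

## Why
The (M) line «rebased-M» (v5, door-c2 gen 10) closes crux r2 from ONE research stub whose value clause is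
written in DESCENDED currency: `L(0) = u · (log_{ω_W} Q / c_V)²` with `log_{ω_W} Q = logOmega W p ι_p Q ∈ ℚ_p`,
`W = C₂ • ((D • V) ⊗ χ_{p*})` the door curve presented on its partner `V` (MULTIPLICATIVE at `p`, `p ∥ N_V`)
and `Q ∈ W(K)` the descent of the genus-twisted conductor-`p` point `z = Σ_τ s(τ) τ·y ∈ V(K[p])`. A printed
conductor-`p` value formula (the shape of Castella–Hsieh, Math. Ann. 370 (2018) Thm. 5.7, typed for the good
cell as `castellaHsieh2018_branchValue_conductorP`) is stated on the PARTNER's side: `𝓛(χ)² = A · (log_{ω_V} j_* z / c_V)²`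
with the logarithm over `ℂ_p ∋ j(θ)`, `θ² = p*`. door-c3 gen 10 proved the glue
`(log_{ω_{W'}} j_* z)² = p* · (u_{C₂}u_D)⁻² · (log_{ω_W} Q)²` (`KYRead.LogDescent.sq_padicLog_map_eq_of_descent`)
under `p ∤ Δ_{W'}` — the GOOD partner of the (G-ord, `e = 2`) cell. On the (M) cell `p ∣ Δ_V`, and that
hypothesis is used in exactly one place: the bound `|u| ≥ 1` for the composite change `u = u_{C₂}u_D·θ⁻¹`.

## What is proved (theorems only; no definition, no new fact)
* §1 `one_le_val_compositeU_of_padicValRat_le` — `|u_{C₂}u_D·(jθ)⁻¹| ≥ 1` in any `F ⊇ ℚ_p` (isometric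
  structure map) as soon as `v_p(u_{C₂}u_D) ≤ 0` and `v_p(d) ≥ 0` (`(jθ)² = d`): no discriminant needed.
* §2 `padicLog_map_eq_mul_logOmega_of_descent_of_padicValRat_le` and its square — door-c3's descent identity
  `log_{ω_{W'}}(j_* z) = j(θ)·(u_{C₂}u_D)⁻¹·e(log_{ω_W} Q)` with `hΔ'` REPLACED by the two valuation hypotheses;
  valid for EVERY reduction type of the partner (the proof is door-c3's, Step C swapped for §1).
* §3 the door's instances: for a partner SEMISTABLE at `p` (`Good V p ∨ Mult V p`, `p ≠ 2`, `d = p*`) the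
  presentation constant is a `p`-adic unit, `v_p(u_{C₂}u_D) = 0` (`padicValRat_presentationU_eq_zero_of_semistable`,
  from `Additive.padicValRat_u_eq_zero_of_twist_pm_p` = twist-minimality at `p`), hence the descent identity and
  its square hold on BOTH cells of the door — in particular on (M) (`sq_padicLog_map_eq_of_descent_of_semistable`).
* §4 the value-clause transfer at one datum, shape-agnostic: a print-side clause
  `L.HasValueAt 0 (A · (log_{ω_V} j_* z / c)²)` becomes the stub-side clause
  `L.HasValueAt 0 ((A · p* · (u_{C₂}u_D)⁻²) · (log_{ω_W} Q / c)²)` read along `e = algebraMap ℚ_p F`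
  (`hasValueAt_descended_of_hasValueAt_partner`), with `‖(u_{C₂}u_D : ℚ_p)‖ = 1` recorded for the cofactor
  bookkeeping (`norm_presentationU_eq_one_of_semistable`).

HONEST FRAMING: a theorem about logarithms of points under isomorphisms of Weierstrass models; it proves
nothing printed about `p`-adic `L`-functions, asserts no value formula at `p ∥ N_V` (none is in print —
door-c2 «find» ×11), and does not close the crux. Theses-free (imports Theorems files that are Theses-free and
Literature). Every decl is a theorem; standard axioms only.

References: Silverman *AEC* III.1 Table 3.1, VII.1 (minimal models, `Δ' = u⁻¹²Δ`), IV.6.4, X.5 Cor. 5.4;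
Castella–Hsieh, Math. Ann. 370 (2018) Lemma 5.4, Thm. 5.7 (shape of the conductor-`p` value, `p ∤ N`);
Keller–Yin arXiv:2410.23241 §3.4–3.5 and p. 15 (the multiplicative branch named open).
-/

noncomputable section

open scoped Classical NNReal

open WeierstrassCurve NumberField IsDedekindDomain Field
  Literature.NumberTheory.EllipticCurves
  Literature.NumberTheory.EllipticCurves.FormalGroupChart
  Literature.NumberTheory.EllipticCurves.Rank1Residual
  Summit.BirchSwinnertonDyer.Rank1Residual
  Summit.BirchSwinnertonDyer.Rank1Residual.X11b
  Summit.BirchSwinnertonDyer.Rank1Residual.X11b.Halves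
  Summit.BirchSwinnertonDyer.BirchSwinnertonDyer.Theorems.SchneiderFree.KYRead.LogDescent

set_option linter.dupNamespace false
set_option autoImplicit false

namespace Summit.BirchSwinnertonDyer.BirchSwinnertonDyer.Theorems.SchneiderFree.PotMultRead.LogDescent

/-! ## §1 `|u| ≥ 1` for the composite change from valuations alone -/

section UnitBound

variable (p : ℕ) [Fact p.Prime] (D C₂ : VariableChange ℚ) (d : ℚ)
  {F : Type} [NontriviallyNormedField F] [IsUltrametricDist F]

omit [IsUltrametricDist F] in
/-- The norm of a rational number read in `F ⊇ ℚ_p` (isometric structure map): `‖q‖_F = p^{-v_p(q)}` for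
`q ≠ 0`. [folklore] -/
theorem norm_algebraMap_rat_eq_zpow [CharZero F] (e : ℚ_[p] →+* F) (he : ∀ x, ‖e x‖ = ‖x‖) {q : ℚ}
    (hq : q ≠ 0) : ‖algebraMap ℚ F q‖ = (p : ℝ) ^ (-padicValRat p q) := by
  rw [eq_ratCast, ← map_ratCast e q, he, Padic.eq_padicNorm, padicNorm.eq_zpow_of_nonzero hq]
  push_cast
  rfl

/-- **`|u_{C₂} u_D · θ⁻¹| ≥ 1` from valuations**: in any `F ⊇ ℚ_p` with isometric structure map, if
`v_p(u_{C₂}u_D) ≤ 0`, `v_p(d) ≥ 0` and `θ² = d`, `θ ≠ 0`, then the composite change `C₂ · ι_θ⁻¹ · D` has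
`|u| = |u_{C₂}u_D|·|θ|⁻¹ ≥ 1`. No discriminant, no reduction type. [cite: SilvermanAEC2009, III.1 Table 3.1] -/
theorem one_le_val_compositeU_of_padicValRat_le [CharZero F] (e : ℚ_[p] →+* F) (he : ∀ x, ‖e x‖ = ‖x‖)
    {θ : F} (hθ2 : θ ^ 2 = algebraMap ℚ F d) (hθ : θ ≠ 0)
    (hu : padicValRat p (C₂.u * D.u : ℚ) ≤ 0) (hd : 0 ≤ padicValRat p d) :
    1 ≤ NormedField.valuation
      ((C₂.map (algebraMap ℚ F) * ((untwistAt hθ)⁻¹ * D.map (algebraMap ℚ F))).u : F) := by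
  have hp : p.Prime := Fact.out
  have hp1 : (1 : ℝ) ≤ p := by exact_mod_cast hp.one_lt.le
  rw [compositeChange_u (L := F) D C₂ hθ, NormedField.valuation_apply, ← NNReal.coe_le_coe, coe_nnnorm,
    NNReal.coe_one, norm_mul, norm_inv]
  -- `‖u_{C₂} u_D‖ ≥ 1`
  have hq0 : (C₂.u * D.u : ℚ) ≠ 0 := mul_ne_zero C₂.u.ne_zero D.u.ne_zero
  have h1 : 1 ≤ ‖algebraMap ℚ F (C₂.u * D.u : ℚ)‖ := by
    rw [norm_algebraMap_rat_eq_zpow p e he hq0]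
    exact one_le_zpow₀ hp1 (by linarith)
  -- `‖θ‖ ≤ 1`
  have hd0 : d ≠ 0 := by
    rintro rfl
    rw [map_zero] at hθ2
    exact hθ (pow_eq_zero_iff (two_ne_zero) |>.mp hθ2)
  have h2 : ‖θ‖ ≤ 1 := by
    have hsq : ‖θ‖ ^ 2 ≤ 1 := by
      rw [← norm_pow, hθ2, norm_algebraMap_rat_eq_zpow p e he hd0]
      exact zpow_le_one_of_nonpos₀ hp1 (by linarith)
    exact (pow_le_one_iff_of_nonneg (norm_nonneg _) two_ne_zero).mp hsq
  have h3 : 1 ≤ ‖θ‖⁻¹ := (one_le_inv₀ (norm_pos_iff.mpr hθ)).mpr h2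
  exact one_le_mul_of_one_le_of_one_le h1 h3

end UnitBound

/-! ## §2 The twist descent of the logarithm, reduction-type free -/

section Descent

variable (p : ℕ) [Fact p.Prime] (W' : WeierstrassCurve ℚ) [W'.IsGloballyMinimal]
  (D C₂ : VariableChange ℚ) [(D • W').IsCharNeTwoNF] (d : ℚ)
  [(C₂ • (D • W').quadraticTwist d).IsElliptic] [(C₂ • (D • W').quadraticTwist d).IsGloballyMinimal]
  {K : Type} [Field K] [NumberField K] {L : Type*} [Field L] [Algebra ℚ L] [Algebra K L]
  {F : Type} [NontriviallyNormedField F] [IsUltrametricDist F] [CompleteSpace F] [CharZero F]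

/-- **Twist descent of the `p`-adic logarithm, for EVERY reduction type of the partner.** Let
`W = C₂ • ((D • W') ⊗ χ_d)` be the door curve presented on a globally minimal partner `W'` (`D`, `C₂`
rational changes of variables), `θ ∈ L` a square root of `d` in a field `L ⊇ K`, `z ∈ W'(L)` and `Q ∈ W(K)`
with `Q = ι_{C₂}(ι_θ⁻¹(ι_D z))` in `W(L)` (the door's descent equation). Then in ANY complete nonarchimedean
`F ⊇ ℚ_p` (structure map `e` isometric; MEANT `F = ℂ_p`), along any `ι_p : K → ℚ_p`, `j : L → F` with
`j|_K = e ∘ ι_p`, and provided `v_p(u_{C₂} u_D) ≤ 0` and `v_p(d) ≥ 0`: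
`log_{ω_{W'}}(j_* z) = j(θ) · (u_{C₂}u_D)⁻¹ · e(log_{ω_W}(Q))`, where `log_{ω_W}(Q) = logOmega W p ι_p Q ∈ ℚ_p`
is the receptacle's logarithm and `log_{ω_{W'}}` the `F`-valued `padicLogPointFiniteExt` of the minimal model
`W'`. This is door-c3 gen 10's `padicLog_map_eq_mul_logOmega_of_descent` with its hypothesis `p ∤ Δ_{W'}`
replaced by the two valuation inequalities (its only use was `|u| ≥ 1`, now §1); the rest of the proof is
VERBATIM theirs: `W_F = (C₂ · ι_{jθ}⁻¹ · D) • W'_F` (`compositeChange_smul`), the descent equation read in `F`,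
and the general change-of-variables rule for `log_ω`
(`padicLogPointFiniteExt_pointMap_of_variableChange_of_one_le_of_completeSpace`).
[cite: SilvermanAEC2009, III.1 Table 3.1 with Thm. IV.6.4 and X.5 Cor. 5.4]
[cite: CastellaHsieh2018, Thm. 5.7 (shape: the logarithm of the twisted Heegner class over the ramified completion)] -/
theorem padicLog_map_eq_mul_logOmega_of_descent_of_padicValRat_le
    {θ : L} (hθ2 : θ ^ 2 = algebraMap ℚ L d) (hθ : θ ≠ 0)
    (z : (W'.baseChange L).toAffine.Point)
    (Q : ((C₂ • (D • W').quadraticTwist d).baseChange K).toAffine.Point)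
    (hQ : WeierstrassCurve.Affine.Point.map (algebraMap K L).toRatAlgHom Q =
      VariableChange.pointEquivBaseChange ((D • W').quadraticTwist d) C₂ L
        ((VariableChange.pointEquiv (((D • W').quadraticTwist d).baseChange L) (untwistAt hθ)).symm
          ((Affine.Point.congrEquiv (untwistAt_smul_eq (D • W') hθ2 hθ)).symm
            (VariableChange.pointEquivBaseChange W' D L z))))
    (ι_p : K →+* ℚ_[p]) (e : ℚ_[p] →+* F) (he : ∀ x, ‖e x‖ = ‖x‖) (j : L →+* F)
    (hj : ∀ x : K, j (algebraMap K L x) = e (ι_p x))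
    (hu : padicValRat p (C₂.u * D.u : ℚ) ≤ 0) (hd : 0 ≤ padicValRat p d) :
    haveI := isIntegral_valuation_baseChange W' F
    padicLogPointFiniteExt NormedField.valuation (W'.baseChange F) p
        (WeierstrassCurve.Affine.Point.map j.toRatAlgHom z) =
      j θ * (algebraMap ℚ F (C₂.u * D.u : ℚ))⁻¹ *
        e (logOmega (C₂ • (D • W').quadraticTwist d) p ι_p Q) := by
  -- adapted from `…KYReadLogDescent.lean` (door-c3 gen 10), Step C replaced by §1
  haveI hintW' := isIntegral_valuation_baseChange W' F
  haveI hintW := isIntegral_valuation_baseChange (C₂ • (D • W').quadraticTwist d) F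
  obtain ⟨hp0', hp1'⟩ := natCast_ne_zero_and_val_lt_one_of_isometry p e he
  -- the square root of `d` in `F`
  have hj'app : ∀ x, j.toRatAlgHom x = j x := fun x ↦ rfl
  have hθ'2 : (j θ) ^ 2 = algebraMap ℚ F d := by
    rw [← map_pow, hθ2, ← hj'app, AlgHom.commutes]
  have hθ'0 : j θ ≠ 0 := (map_ne_zero j).mpr hθ
  -- the composite change of variables over `F` and the model equality
  have hCV := compositeChange_smul (L := F) W' D C₂ d hθ'2 hθ'0
  haveI hintC : ((C₂.map (algebraMap ℚ F) * ((untwistAt hθ'0)⁻¹ * D.map (algebraMap ℚ F))) •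
      W'.baseChange F).IsIntegral (NormedField.valuation (K := F)).integer := by
    rw [hCV]; exact hintW
  -- Step A: the descent equation read in `F`
  have hcomp : (j.toRatAlgHom).comp (algebraMap K L).toRatAlgHom =
      (e.toRatAlgHom).comp ι_p.toRatAlgHom := by
    apply AlgHom.ext
    intro x
    simp only [AlgHom.coe_comp, Function.comp_apply, RingHom.toRatAlgHom_apply]
    exact hj x
  have hjθ : j.toRatAlgHom θ = (((1 : ℤˣ) : ℤ) : F) * j θ := by
    rw [Units.val_one, Int.cast_one, one_mul]; rfl
  have hQC : WeierstrassCurve.Affine.Point.map e.toRatAlgHom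
      (X11b.padicPointOf (C₂ • (D • W').quadraticTwist d) p ι_p Q) =
      Affine.Point.congrEquiv hCV (VariableChange.pointMap (W'.baseChange F)
        (C₂.map (algebraMap ℚ F) * ((untwistAt hθ'0)⁻¹ * D.map (algebraMap ℚ F)))
        (WeierstrassCurve.Affine.Point.map j.toRatAlgHom z)) := by
    rw [X11b.padicPointOf, WeierstrassCurve.Affine.Point.map_map, ← hcomp,
      ← WeierstrassCurve.Affine.Point.map_map, hQ, VariableChange.pointEquivBaseChange_map,
      map_untwist_symm_of_eq_units (D • W') hθ2 hθ hθ'2 hθ'0 j.toRatAlgHom 1 hjθ,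
      Units.val_one, one_zsmul, VariableChange.pointEquivBaseChange_map,
      descendedPoint_eq_congrEquiv_pointMap W' D C₂ d hθ'2 hθ'0]
  -- Step B: the receptacle's logarithm read in `F`, and a multiple of `Q` in the level
  obtain ⟨hlogQ, hmQ, hm⟩ :=
    map_logOmega_eq_padicLogPointFiniteExt p e he (C₂ • (D • W').quadraticTwist d) ι_p Q
  rw [hQC, ← map_nsmul, congrEquiv_mem_level_iff hCV] at hmQ
  rw [hQC, padicLogPointFiniteExt_congrEquiv hCV] at hlogQ
  -- Step C (NEW): `|u| ≥ 1` from the valuations of `u_{C₂}u_D` and `d` alone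
  have hu1 := one_le_val_compositeU_of_padicValRat_le p D C₂ d e he hθ'2 hθ'0 hu hd
  -- Step D: the change-of-variables rule for `log_ω`
  have key := padicLogPointFiniteExt_pointMap_of_variableChange_of_one_le_of_completeSpace
    (V := W'.baseChange F) hp0' hp1' hu1 hm hmQ
  rw [← hlogQ, compositeChange_u (L := F) D C₂ hθ'0] at key
  -- solve for `log z`
  have hu0 : algebraMap ℚ F (C₂.u * D.u : ℚ) ≠ 0 := by
    rw [map_ne_zero]; exact mul_ne_zero C₂.u.ne_zero D.u.ne_zero
  have e1 : padicLogPointFiniteExt NormedField.valuation (W'.baseChange F) p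
        (WeierstrassCurve.Affine.Point.map j.toRatAlgHom z) =
      ((algebraMap ℚ F (C₂.u * D.u : ℚ)) * (j θ)⁻¹)⁻¹ *
        e (logOmega (C₂ • (D • W').quadraticTwist d) p ι_p Q) := by
    rw [key, ← mul_assoc, inv_mul_cancel₀ (mul_ne_zero hu0 (inv_ne_zero hθ'0)), one_mul]
  rw [e1, mul_inv, inv_inv, mul_comm (algebraMap ℚ F (C₂.u * D.u : ℚ))⁻¹]

/-- **The squared form, reduction-type free**: `(log_{ω_{W'}} j_* z)² = d · (u_{C₂} u_D)⁻² · e(log_{ω_W} Q)²`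
under `v_p(u_{C₂}u_D) ≤ 0`, `v_p(d) ≥ 0`. [cite: SilvermanAEC2009, III.1 Table 3.1 with Thm. IV.6.4 and X.5 Cor. 5.4] -/
theorem sq_padicLog_map_eq_of_descent_of_padicValRat_le
    {θ : L} (hθ2 : θ ^ 2 = algebraMap ℚ L d) (hθ : θ ≠ 0)
    (z : (W'.baseChange L).toAffine.Point)
    (Q : ((C₂ • (D • W').quadraticTwist d).baseChange K).toAffine.Point)
    (hQ : WeierstrassCurve.Affine.Point.map (algebraMap K L).toRatAlgHom Q =
      VariableChange.pointEquivBaseChange ((D • W').quadraticTwist d) C₂ L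
        ((VariableChange.pointEquiv (((D • W').quadraticTwist d).baseChange L) (untwistAt hθ)).symm
          ((Affine.Point.congrEquiv (untwistAt_smul_eq (D • W') hθ2 hθ)).symm
            (VariableChange.pointEquivBaseChange W' D L z))))
    (ι_p : K →+* ℚ_[p]) (e : ℚ_[p] →+* F) (he : ∀ x, ‖e x‖ = ‖x‖) (j : L →+* F)
    (hj : ∀ x : K, j (algebraMap K L x) = e (ι_p x))
    (hu : padicValRat p (C₂.u * D.u : ℚ) ≤ 0) (hd : 0 ≤ padicValRat p d) :
    haveI := isIntegral_valuation_baseChange W' F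
    (padicLogPointFiniteExt NormedField.valuation (W'.baseChange F) p
        (WeierstrassCurve.Affine.Point.map j.toRatAlgHom z)) ^ 2 =
      algebraMap ℚ F d * ((algebraMap ℚ F (C₂.u * D.u : ℚ))⁻¹) ^ 2 *
        (e (logOmega (C₂ • (D • W').quadraticTwist d) p ι_p Q)) ^ 2 := by
  have hj'app : ∀ x, j.toRatAlgHom x = j x := fun x ↦ rfl
  have hθ'2 : (j θ) ^ 2 = algebraMap ℚ F d := by
    rw [← map_pow, hθ2, ← hj'app, AlgHom.commutes]
  rw [padicLog_map_eq_mul_logOmega_of_descent_of_padicValRat_le p W' D C₂ d hθ2 hθ z Q hQ ι_p e he j hj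
    hu hd, mul_pow, mul_pow, hθ'2]

end Descent

/-! ## §3 The door's instances: a partner SEMISTABLE at `p` (both cells; in particular the (M) cell) -/

section Door

variable {p : ℕ} [Fact p.Prime]

omit [Fact p.Prime] in
/-- `v_p(p*) ≥ 0` for `p* = (−1)^{(p−1)/2} p` (an integer). [folklore] -/
theorem padicValRat_pStar_nonneg : 0 ≤ padicValRat p ((-1 : ℚ) ^ (p / 2) * p) := by
  obtain ⟨hcast, -⟩ := Additive.pStar_intCast (p := p)
  rw [← hcast, padicValRat.of_int]
  exact Int.natCast_nonneg _

omit [Fact p.Prime] in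
/-- The presentation `W = C₂ • ((D • V) ⊗ χ_{p*})` as ONE change of variables on the twist of the partner:
`(C₂ · ⟨u_D, p* r_D, 0, 0⟩) • V^{(p*)} = W`. [cite: SilvermanAEC2009, X.5 Cor. 5.4] -/
theorem presentation_smul_quadraticTwist_eq (V : WeierstrassCurve ℚ) (D C₂ : VariableChange ℚ) :
    (C₂ * ⟨D.u, ((-1 : ℚ) ^ (p / 2) * p) * D.r, 0, 0⟩) • V.quadraticTwist ((-1 : ℚ) ^ (p / 2) * p) =
      C₂ • (D • V).quadraticTwist ((-1 : ℚ) ^ (p / 2) * p) := by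
  rw [mul_smul, ← quadraticTwist_smul]

variable (V : WeierstrassCurve ℚ) [V.IsElliptic] [V.IsGloballyMinimal] (D C₂ : VariableChange ℚ)
  [(D • V).IsCharNeTwoNF]
  [(C₂ • (D • V).quadraticTwist ((-1 : ℚ) ^ (p / 2) * p)).IsElliptic]
  [(C₂ • (D • V).quadraticTwist ((-1 : ℚ) ^ (p / 2) * p)).IsGloballyMinimal]

omit [(D • V).IsCharNeTwoNF] [(C₂ • (D • V).quadraticTwist ((-1 : ℚ) ^ (p / 2) * p)).IsElliptic] in
/-- **The presentation constant of a door curve on a SEMISTABLE partner is a `p`-adic unit:** for `p ≠ 2`,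
`V` globally minimal with `Good V p ∨ Mult V p`, and `W = C₂ • ((D • V) ⊗ χ_{p*})` globally minimal,
`v_p(u_{C₂} u_D) = 0` — the twisted model of a curve semistable at `p` is minimal at `p` (twist-minimality,
`Additive.padicValRat_u_eq_zero_of_twist_pm_p`). On the (M) cell this is `v_p Δ_min(W) = 6 + v_p Δ_min(V)`.
[cite: SilvermanAEC2009, VII.1 (minimal models; Δ' = u⁻¹²Δ, c₄' = u⁻⁴c₄)] -/
theorem padicValRat_presentationU_eq_zero_of_semistable (hp2 : p ≠ 2) (hV : Good V p ∨ Mult V p) :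
    padicValRat p (C₂.u * D.u : ℚ) = 0 := by
  obtain ⟨hcast, hd⟩ := Additive.pStar_intCast (p := p)
  have hC : (C₂ * ⟨D.u, ((-1 : ℚ) ^ (p / 2) * p) * D.r, 0, 0⟩) •
      V.quadraticTwist ((((-1 : ℤ) ^ (p / 2) * p : ℤ)) : ℚ) =
      C₂ • (D • V).quadraticTwist ((-1 : ℚ) ^ (p / 2) * p) := by
    rw [hcast]; exact presentation_smul_quadraticTwist_eq V D C₂
  have h := Additive.padicValRat_u_eq_zero_of_twist_pm_p p hp2 V
    (C₂ • (D • V).quadraticTwist ((-1 : ℚ) ^ (p / 2) * p)) hV hd _ hC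
  simpa only [VariableChange.mul_def, Units.val_mul] using h

omit [(D • V).IsCharNeTwoNF] [(C₂ • (D • V).quadraticTwist ((-1 : ℚ) ^ (p / 2) * p)).IsElliptic] in
/-- `‖u_{C₂} u_D‖_p = 1` (the cofactor bookkeeping form of the previous theorem). [cite: SilvermanAEC2009, VII.1] -/
theorem norm_presentationU_eq_one_of_semistable (hp2 : p ≠ 2) (hV : Good V p ∨ Mult V p) :
    ‖((C₂.u * D.u : ℚ) : ℚ_[p])‖ = 1 := by
  have hq0 : (C₂.u * D.u : ℚ) ≠ 0 := mul_ne_zero C₂.u.ne_zero D.u.ne_zero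
  rw [Padic.eq_padicNorm, padicNorm.eq_zpow_of_nonzero hq0,
    padicValRat_presentationU_eq_zero_of_semistable V D C₂ hp2 hV, neg_zero, zpow_zero]
  norm_num

variable {K : Type} [Field K] [NumberField K] {L : Type*} [Field L] [Algebra ℚ L] [Algebra K L]
  {F : Type} [NontriviallyNormedField F] [IsUltrametricDist F] [CompleteSpace F] [CharZero F]

/-- **Twist descent of the logarithm on the door, partner SEMISTABLE at `p` (both cells, in particular (M)):**
for `p ≠ 2`, `V` globally minimal with `Good V p ∨ Mult V p`, `W = C₂ • ((D • V) ⊗ χ_{p*})` globally minimal,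
`θ² = p*` in `L ⊇ K`, `z ∈ V(L)`, `Q ∈ W(K)` descending `z`, and `F ⊇ ℚ_p` complete with isometric `e`,
`j : L → F` over `e ∘ ι_p`:
`log_{ω_V}(j_* z) = j(θ) · (u_{C₂}u_D)⁻¹ · e(log_{ω_W} Q)`. On the (G-ord) cell this is door-c3 gen 10's theorem;
on the (M) cell (`Mult V p`, `p ∣ Δ_V`) it is NEW. [cite: SilvermanAEC2009, III.1 Table 3.1 with Thm. IV.6.4 and X.5 Cor. 5.4]
[cite: CastellaHsieh2018, Thm. 5.7 (shape)] -/
theorem padicLog_map_eq_mul_logOmega_of_descent_of_semistable (hp2 : p ≠ 2) (hV : Good V p ∨ Mult V p)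
    {θ : L} (hθ2 : θ ^ 2 = algebraMap ℚ L ((-1 : ℚ) ^ (p / 2) * p)) (hθ : θ ≠ 0)
    (z : (V.baseChange L).toAffine.Point)
    (Q : ((C₂ • (D • V).quadraticTwist ((-1 : ℚ) ^ (p / 2) * p)).baseChange K).toAffine.Point)
    (hQ : WeierstrassCurve.Affine.Point.map (algebraMap K L).toRatAlgHom Q =
      VariableChange.pointEquivBaseChange ((D • V).quadraticTwist ((-1 : ℚ) ^ (p / 2) * p)) C₂ L
        ((VariableChange.pointEquiv (((D • V).quadraticTwist
            ((-1 : ℚ) ^ (p / 2) * p)).baseChange L) (untwistAt hθ)).symm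
          ((Affine.Point.congrEquiv (untwistAt_smul_eq (D • V) hθ2 hθ)).symm
            (VariableChange.pointEquivBaseChange V D L z))))
    (ι_p : K →+* ℚ_[p]) (e : ℚ_[p] →+* F) (he : ∀ x, ‖e x‖ = ‖x‖) (j : L →+* F)
    (hj : ∀ x : K, j (algebraMap K L x) = e (ι_p x)) :
    haveI := isIntegral_valuation_baseChange V F
    padicLogPointFiniteExt NormedField.valuation (V.baseChange F) p
        (WeierstrassCurve.Affine.Point.map j.toRatAlgHom z) =
      j θ * (algebraMap ℚ F (C₂.u * D.u : ℚ))⁻¹ *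
        e (logOmega (C₂ • (D • V).quadraticTwist ((-1 : ℚ) ^ (p / 2) * p)) p ι_p Q) :=
  padicLog_map_eq_mul_logOmega_of_descent_of_padicValRat_le p V D C₂ _ hθ2 hθ z Q hQ ι_p e he j hj
    (padicValRat_presentationU_eq_zero_of_semistable V D C₂ hp2 hV).le padicValRat_pStar_nonneg

/-- **The squared form on the door, partner semistable at `p`:**
`(log_{ω_V} j_* z)² = p* · (u_{C₂}u_D)⁻² · e(log_{ω_W} Q)²`. [cite: SilvermanAEC2009, III.1 Table 3.1 with Thm. IV.6.4 and X.5 Cor. 5.4] -/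
theorem sq_padicLog_map_eq_of_descent_of_semistable (hp2 : p ≠ 2) (hV : Good V p ∨ Mult V p)
    {θ : L} (hθ2 : θ ^ 2 = algebraMap ℚ L ((-1 : ℚ) ^ (p / 2) * p)) (hθ : θ ≠ 0)
    (z : (V.baseChange L).toAffine.Point)
    (Q : ((C₂ • (D • V).quadraticTwist ((-1 : ℚ) ^ (p / 2) * p)).baseChange K).toAffine.Point)
    (hQ : WeierstrassCurve.Affine.Point.map (algebraMap K L).toRatAlgHom Q =
      VariableChange.pointEquivBaseChange ((D • V).quadraticTwist ((-1 : ℚ) ^ (p / 2) * p)) C₂ L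
        ((VariableChange.pointEquiv (((D • V).quadraticTwist
            ((-1 : ℚ) ^ (p / 2) * p)).baseChange L) (untwistAt hθ)).symm
          ((Affine.Point.congrEquiv (untwistAt_smul_eq (D • V) hθ2 hθ)).symm
            (VariableChange.pointEquivBaseChange V D L z))))
    (ι_p : K →+* ℚ_[p]) (e : ℚ_[p] →+* F) (he : ∀ x, ‖e x‖ = ‖x‖) (j : L →+* F)
    (hj : ∀ x : K, j (algebraMap K L x) = e (ι_p x)) :
    haveI := isIntegral_valuation_baseChange V F
    (padicLogPointFiniteExt NormedField.valuation (V.baseChange F) p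
        (WeierstrassCurve.Affine.Point.map j.toRatAlgHom z)) ^ 2 =
      algebraMap ℚ F ((-1 : ℚ) ^ (p / 2) * p) * ((algebraMap ℚ F (C₂.u * D.u : ℚ))⁻¹) ^ 2 *
        (e (logOmega (C₂ • (D • V).quadraticTwist ((-1 : ℚ) ^ (p / 2) * p)) p ι_p Q)) ^ 2 :=
  sq_padicLog_map_eq_of_descent_of_padicValRat_le p V D C₂ _ hθ2 hθ z Q hQ ι_p e he j hj
    (padicValRat_presentationU_eq_zero_of_semistable V D C₂ hp2 hV).le padicValRat_pStar_nonneg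

/-! ## §4 The value-clause transfer at one datum (print side ⟶ stub side), shape-agnostic -/

/-- **Value-clause transfer, partner side ⟶ descended side.** At one door datum with the partner semistable at
`p`: if a series `L ∈ R₀⟦T⟧` has the print-shaped value
`L(0) = A · (log_{ω_V}(j_* z) / c)²` (logarithm over `F ∋ j(θ)`, ANY cofactor `A ∈ F` — e.g. the
`u · p⁻¹` of a Castella–Hsieh-shaped conductor-`p` formula), then it has the stub-shaped value
`L(0) = (A · p* · (u_{C₂}u_D)⁻²) · e(log_{ω_W} Q / c)²` in the descended currency of `PotMultRead.KYCHMOrientedX3`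
(`e = algebraMap ℚ_p ℂ_p` there), with `‖u_{C₂}u_D‖_p = 1` (`norm_presentationU_eq_one_of_semistable`) for the
integrality / unit bookkeeping of the new cofactor. Stated for an arbitrary predicate-free target value: the
conclusion is the EQUALITY of the two right-hand sides, so it rewrites inside any `HasValueAt`-type clause.
[cite: SilvermanAEC2009, III.1 Table 3.1 with Thm. IV.6.4 and X.5 Cor. 5.4] [cite: CastellaHsieh2018, Thm. 5.7 (shape)] -/
theorem partnerValue_eq_descendedValue_of_semistable (hp2 : p ≠ 2) (hV : Good V p ∨ Mult V p)
    {θ : L} (hθ2 : θ ^ 2 = algebraMap ℚ L ((-1 : ℚ) ^ (p / 2) * p)) (hθ : θ ≠ 0)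
    (z : (V.baseChange L).toAffine.Point)
    (Q : ((C₂ • (D • V).quadraticTwist ((-1 : ℚ) ^ (p / 2) * p)).baseChange K).toAffine.Point)
    (hQ : WeierstrassCurve.Affine.Point.map (algebraMap K L).toRatAlgHom Q =
      VariableChange.pointEquivBaseChange ((D • V).quadraticTwist ((-1 : ℚ) ^ (p / 2) * p)) C₂ L
        ((VariableChange.pointEquiv (((D • V).quadraticTwist
            ((-1 : ℚ) ^ (p / 2) * p)).baseChange L) (untwistAt hθ)).symm
          ((Affine.Point.congrEquiv (untwistAt_smul_eq (D • V) hθ2 hθ)).symm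
            (VariableChange.pointEquivBaseChange V D L z))))
    (ι_p : K →+* ℚ_[p]) (e : ℚ_[p] →+* F) (he : ∀ x, ‖e x‖ = ‖x‖) (j : L →+* F)
    (hj : ∀ x : K, j (algebraMap K L x) = e (ι_p x)) (A : F) (c : ℚ_[p]) :
    haveI := isIntegral_valuation_baseChange V F
    A * (padicLogPointFiniteExt NormedField.valuation (V.baseChange F) p
        (WeierstrassCurve.Affine.Point.map j.toRatAlgHom z) / e c) ^ 2 =
      (A * algebraMap ℚ F ((-1 : ℚ) ^ (p / 2) * p) * ((algebraMap ℚ F (C₂.u * D.u : ℚ))⁻¹) ^ 2) *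
        (e (logOmega (C₂ • (D • V).quadraticTwist ((-1 : ℚ) ^ (p / 2) * p)) p ι_p Q / c)) ^ 2 := by
  rw [div_pow, sq_padicLog_map_eq_of_descent_of_semistable V D C₂ hp2 hV hθ2 hθ z Q hQ ι_p e he j hj,
    map_div₀, div_pow]
  ring

end Door

end Summit.BirchSwinnertonDyer.BirchSwinnertonDyer.Theorems.SchneiderFree.PotMultRead.LogDescent

end
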